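import Summits.Ventures.PercRepro.RankLevelSetLevelTenInfraGXT

/-!
# PercRepro — THE LEVEL-`11` INFRASTRUCTURE OF THE GXT CHAIN: the flat bound `f(11) ≤ 1279`, the intersection cap
`ν_∩ ≤ 629`, the `Icc 3 12` sum, `C(m + 11, 11)·11!`, the tail doubling step, the mid-sum split at level `11`, and the
TRUNCATED `Y`-TAIL LEMMAS (p2, gen 36; a feeder for S4 — the top of the `q = 11` window, from `1,554`)

Every level statement is the level-`11` instance of a level-`10` statement of the tree (RankLevelSetLevelTenInfraGXT),
proved the same way:
* `ncard_le_twelve_seventy_nine_of_eRk_le_eleven_of_free` — `f(11) ≤ 1279 = 2·639 + 1` (night-1's doubling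
  `ncard_le_two_mul_add_one_of_free` on `f(10) ≤ 639`);
* `hinter_eleven` — every rank-`≤ 10` set of the `e`-free core has `≤ r(X) + min 629 d` points (`639 = 10 + 629`);
* `sum_Icc_three_twelve_q`, `Explicit.choose_eleven_mul` (`11!·C(m + 11, 11) = (m + 1)⋯(m + 11)`);
* `mul_tailG_eleven_le_of_base` — the level-`11` tail `G₁₁` from a base, any constants (every term at most doubles);
* `sum_Ico_choose_add_sum_range_choose_le_eleven`.
THE TRUNCATED TAILS (new; generic in `n`): the spanning tail `Σ_{j ≤ d} C(n, j)` of a base inequality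
`a·(G′ + Σ_{j ≤ d} C(n, j)) ≤ b·2^n` is never expanded term by term again —
* below the middle (`2m ≤ n`) the GEOMETRIC bound `(n + 1 − 2m)·Σ_{j ≤ m} C(n, j) ≤ (n + 1 − m)·C(n, m)`
  (`sum_range_choose_mul_le_of_two_mul_le`: the ratio `C(n, j−1)/C(n, j) ≤ m/(n − m + 1)` for `j ≤ m`) after the top
  `d − m` terms are kept exactly (`tailG_le_of_geom`);
* above the middle the SYMMETRIC COMPLEMENT `Σ_{j ≤ d} C(n, j) + Σ_{j < n − d} C(n, j) = 2^n`
  (`sum_range_choose_add_sum_range_choose_compl`) with a lower bound on the complement by any of its sub-sums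
  (`tailG_le_of_compl`).
Axioms: standard.
-/

set_option exponentiation.threshold 4096

open scoped Matroid

namespace PercRepro

namespace ThmN

open Set

variable {α : Type}

/-- `Σ_{k ∈ Icc 3 12} g k` written out. -/
theorem sum_Icc_three_twelve_q (g : ℕ → ℚ) :
    ∑ k ∈ Finset.Icc 3 12, g k = g 3 + g 4 + g 5 + g 6 + g 7 + g 8 + g 9 + g 10 + g 11 + g 12 := by
  rw [show (12 : ℕ) = 11 + 1 from rfl, Finset.sum_Icc_succ_top (by norm_num), sum_Icc_three_eleven_q]

/-- `11!·C(m + 11, 11) = (m + 1)(m + 2)⋯(m + 11)` (from `Explicit.choose_ten_mul` by `C(n, 11)·11 = C(n, 10)·(n − 10)`). -/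
theorem Explicit.choose_eleven_mul (m : ℕ) :
    39916800 * (m + 11).choose 11 =
      (m + 1) * (m + 2) * (m + 3) * (m + 4) * (m + 5) * (m + 6) * (m + 7) * (m + 8) * (m + 9) * (m + 10) * (m + 11) := by
  have h1 : (m + 11).choose 11 * 11 = (m + 11).choose 10 * (m + 1) := by
    have := Nat.choose_succ_right_eq (m + 11) 10
    rwa [show m + 11 - 10 = m + 1 by omega] at this
  have h2 : 3628800 * (m + 11).choose 10 =
      (m + 2) * (m + 3) * (m + 4) * (m + 5) * (m + 6) * (m + 7) * (m + 8) * (m + 9) * (m + 10) * (m + 11) := by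
    have := Explicit.choose_ten_mul (m + 1)
    rw [show m + 1 + 10 = m + 11 by ring] at this
    rw [this]
  calc 39916800 * (m + 11).choose 11 = 3628800 * ((m + 11).choose 11 * 11) := by ring
    _ = 3628800 * ((m + 11).choose 10 * (m + 1)) := by rw [h1]
    _ = (3628800 * (m + 11).choose 10) * (m + 1) := by ring
    _ = ((m + 2) * (m + 3) * (m + 4) * (m + 5) * (m + 6) * (m + 7) * (m + 8) * (m + 9) * (m + 10) * (m + 11)) * (m + 1) := by
        rw [h2]
    _ = (m + 1) * (m + 2) * (m + 3) * (m + 4) * (m + 5) * (m + 6) * (m + 7) * (m + 8) * (m + 9) * (m + 10) * (m + 11) := by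
        ring

/-- `f(11) ≤ 1279` on the `e`-free core (`1279 = 2·639 + 1`). -/
theorem ncard_le_twelve_seventy_nine_of_eRk_le_eleven_of_free (M : Matroid α) [M.Finite]
    (hfree : ∀ e ∈ M.E, ∃ A ⊆ M.E \ {e}, e ∉ M.closure A ∧ e ∉ M.closure ((M.E \ {e}) \ A)) :
    ∀ X ⊆ M.E, M.eRk X ≤ 11 → X.ncard ≤ 1279 := by
  intro X hX hr
  have := ncard_le_two_mul_add_one_of_free M hfree (k := 10) (B := 639)
    (fun _ hY hrY => ncard_le_six_thirty_nine_of_eRk_le_ten_of_free M hfree _ hY (by exact_mod_cast hrY)) X hX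
    (by exact_mod_cast hr)
  omega

/-- **The intersection cap at level `11`**: every rank-`≤ 10` subset of the `e`-free core of corank `d` has at most
`r(X) + min 629 d` points (the flat bounds `1 / 3 / 6 / 10 / 19 / 39 / 79 / 159 / 319 / 639` and the nullity cap). -/
theorem hinter_eleven (M : Matroid α) [M.Finite] {d : ℕ} (hd : M.E.encard = M.eRank + d)
    (hfree : ∀ e ∈ M.E, ∃ A ⊆ M.E \ {e}, e ∉ M.closure A ∧ e ∉ M.closure ((M.E \ {e}) \ A)) :
    ∀ X ⊆ M.E, M.eRk X ≤ ((11 - 1 : ℕ) : ℕ∞) → (X.ncard : ℕ∞) ≤ M.eRk X + (min 629 d : ℕ) := by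
  intro X hX hr
  obtain ⟨k, hk⟩ := Matroid.exists_eRk_eq_nat (M := M) hX
  rw [hk] at hr ⊢
  have hk10 : k ≤ 10 := by exact_mod_cast hr
  have hcap : X.ncard ≤ k + d := by
    have h1 := Matroid.encard_le_eRk_add_of_encard_eq hX hd
    rw [hk] at h1
    have hfin : X.Finite := M.ground_finite.subset hX
    rw [← hfin.cast_ncard_eq] at h1
    exact_mod_cast h1
  have h629 : X.ncard ≤ k + 629 := by
    rcases Nat.lt_or_ge k 10 with h | h
    · have h9 : M.eRk X ≤ ((10 - 1 : ℕ) : ℕ∞) := by rw [hk]; exact_mod_cast (by omega : k ≤ 10 - 1)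
      have := hinter_ten M hd hfree X hX h9
      rw [hk] at this
      have h310 : X.ncard ≤ k + min 310 d := by exact_mod_cast this
      omega
    · have hk' : k = 10 := by omega
      subst hk'
      have := ncard_le_six_thirty_nine_of_eRk_le_ten_of_free M hfree X hX (le_of_eq hk)
      omega
  have hcard : X.ncard ≤ k + min 629 d := by omega
  exact_mod_cast hcard

/-- **The level-`11` tail from a base, any constants**: `a·G₁₁(d, n₀) ≤ b·2^n₀` with `22 ≤ n₀` gives `a·G₁₁(d, n) ≤ b·2^n` for
every `n ≥ n₀` (every term of `G₁₁` at most doubles from `n` to `n + 1`). -/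
theorem mul_tailG_eleven_le_of_base (a b d n₀ : ℕ) (h22 : 22 ≤ n₀)
    (h : a * (n₀.choose 11 * 2 ^ (min 1268 d) + n₀.choose 10 * 2 ^ 629 + n₀.choose 9 * 2 ^ 310 + n₀.choose 8 * 2 ^ 151 +
      n₀.choose 7 * 2 ^ 72 + n₀.choose 6 * 2 ^ 33 + n₀.choose 5 * 2 ^ 14 + n₀.choose 4 * 2 ^ 6 + n₀.choose 3 * 2 ^ 3 +
      n₀.choose 2 * 2 + n₀ + 1 + ∑ j ∈ Finset.range (d + 1), n₀.choose j) ≤ b * 2 ^ n₀)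
    (n : ℕ) (hn : n₀ ≤ n) :
    a * (n.choose 11 * 2 ^ (min 1268 d) + n.choose 10 * 2 ^ 629 + n.choose 9 * 2 ^ 310 + n.choose 8 * 2 ^ 151 +
      n.choose 7 * 2 ^ 72 + n.choose 6 * 2 ^ 33 + n.choose 5 * 2 ^ 14 + n.choose 4 * 2 ^ 6 + n.choose 3 * 2 ^ 3 +
      n.choose 2 * 2 + n + 1 + ∑ j ∈ Finset.range (d + 1), n.choose j) ≤ b * 2 ^ n := by
  induction n, hn using Nat.le_induction with
  | base => exact h
  | succ n hn ih =>
    have h11 := choose_succ_le_two_mul_of_two_mul_le_cube n 11 (by omega)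
    have h10 := choose_succ_le_two_mul_of_two_mul_le_cube n 10 (by omega)
    have h9 := choose_succ_le_two_mul_of_two_mul_le_cube n 9 (by omega)
    have h8 := choose_succ_le_two_mul_of_two_mul_le_cube n 8 (by omega)
    have h7 := choose_succ_le_two_mul_of_two_mul_le_cube n 7 (by omega)
    have h6 := choose_succ_le_two_mul_of_two_mul_le_cube n 6 (by omega)
    have h5 := choose_succ_le_two_mul_of_two_mul_le_cube n 5 (by omega)
    have h4 := choose_succ_le_two_mul_of_two_mul_le_cube n 4 (by omega)
    have h3 := choose_succ_le_two_mul_of_two_mul_le_cube n 3 (by omega)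
    have h2 := choose_succ_le_two_mul_of_two_mul_le_cube n 2 (by omega)
    have hS := PercRepro.sum_choose_succ_le_two_mul n d
    have hpow : 2 ^ (n + 1) = 2 * 2 ^ n := by ring
    have hG : (n + 1).choose 11 * 2 ^ (min 1268 d) + (n + 1).choose 10 * 2 ^ 629 + (n + 1).choose 9 * 2 ^ 310 +
        (n + 1).choose 8 * 2 ^ 151 + (n + 1).choose 7 * 2 ^ 72 + (n + 1).choose 6 * 2 ^ 33 + (n + 1).choose 5 * 2 ^ 14 +
        (n + 1).choose 4 * 2 ^ 6 + (n + 1).choose 3 * 2 ^ 3 + (n + 1).choose 2 * 2 + (n + 1) + 1 +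
        ∑ j ∈ Finset.range (d + 1), (n + 1).choose j ≤
        2 * (n.choose 11 * 2 ^ (min 1268 d) + n.choose 10 * 2 ^ 629 + n.choose 9 * 2 ^ 310 + n.choose 8 * 2 ^ 151 +
          n.choose 7 * 2 ^ 72 + n.choose 6 * 2 ^ 33 + n.choose 5 * 2 ^ 14 + n.choose 4 * 2 ^ 6 + n.choose 3 * 2 ^ 3 +
          n.choose 2 * 2 + n + 1 + ∑ j ∈ Finset.range (d + 1), n.choose j) := by
      have m11 := Nat.mul_le_mul_right (2 ^ (min 1268 d)) h11
      have m10 := Nat.mul_le_mul_right (2 ^ 629) h10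
      have m9 := Nat.mul_le_mul_right (2 ^ 310) h9
      have m8 := Nat.mul_le_mul_right (2 ^ 151) h8
      have m7 := Nat.mul_le_mul_right (2 ^ 72) h7
      have m6 := Nat.mul_le_mul_right (2 ^ 33) h6
      have m5 := Nat.mul_le_mul_right (2 ^ 14) h5
      have m4 := Nat.mul_le_mul_right (2 ^ 6) h4
      have m3 := Nat.mul_le_mul_right (2 ^ 3) h3
      have m2 := Nat.mul_le_mul_right 2 h2
      rw [mul_assoc] at m11 m10 m9 m8 m7 m6 m5 m4 m3 m2
      omega
    calc a * ((n + 1).choose 11 * 2 ^ (min 1268 d) + (n + 1).choose 10 * 2 ^ 629 + (n + 1).choose 9 * 2 ^ 310 +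
          (n + 1).choose 8 * 2 ^ 151 + (n + 1).choose 7 * 2 ^ 72 + (n + 1).choose 6 * 2 ^ 33 + (n + 1).choose 5 * 2 ^ 14 +
          (n + 1).choose 4 * 2 ^ 6 + (n + 1).choose 3 * 2 ^ 3 + (n + 1).choose 2 * 2 + (n + 1) + 1 +
          ∑ j ∈ Finset.range (d + 1), (n + 1).choose j)
        ≤ a * (2 * (n.choose 11 * 2 ^ (min 1268 d) + n.choose 10 * 2 ^ 629 + n.choose 9 * 2 ^ 310 + n.choose 8 * 2 ^ 151 +
          n.choose 7 * 2 ^ 72 + n.choose 6 * 2 ^ 33 + n.choose 5 * 2 ^ 14 + n.choose 4 * 2 ^ 6 + n.choose 3 * 2 ^ 3 +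
          n.choose 2 * 2 + n + 1 + ∑ j ∈ Finset.range (d + 1), n.choose j)) := Nat.mul_le_mul_left _ hG
      _ = 2 * (a * (n.choose 11 * 2 ^ (min 1268 d) + n.choose 10 * 2 ^ 629 + n.choose 9 * 2 ^ 310 + n.choose 8 * 2 ^ 151 +
          n.choose 7 * 2 ^ 72 + n.choose 6 * 2 ^ 33 + n.choose 5 * 2 ^ 14 + n.choose 4 * 2 ^ 6 + n.choose 3 * 2 ^ 3 +
          n.choose 2 * 2 + n + 1 + ∑ j ∈ Finset.range (d + 1), n.choose j)) := by ring
      _ ≤ 2 * (b * 2 ^ n) := Nat.mul_le_mul_left _ ih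
      _ = b * 2 ^ (n + 1) := by rw [hpow]; ring

/-- `Σ_{k ∈ Ico 11 p} C(n, k) + Σ_{j ≤ d} C(n, j) ≤ 2^n` for `n = p + d`. -/
theorem sum_Ico_choose_add_sum_range_choose_le_eleven (p d : ℕ) :
    ∑ k ∈ Finset.Ico 11 p, (p + d).choose k + ∑ j ∈ Finset.range (d + 1), (p + d).choose j ≤ 2 ^ (p + d) := by
  have h1 : ∑ k ∈ Finset.Ico 11 p, (p + d).choose k ≤ ∑ k ∈ Finset.Ico 10 p, (p + d).choose k :=
    Finset.sum_le_sum_of_subset (Finset.Ico_subset_Ico_left (by omega))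
  have := sum_Ico_choose_add_sum_range_choose_le_ten p d
  omega

/-! ## The truncated tails (generic in `n`) -/

/-- **The symmetric complement of the spanning tail**: for `d < n`,
`Σ_{j ≤ d} C(n, j) + Σ_{j < n − d} C(n, j) = 2^n` (the terms `j > d` reflected by `C(n, j) = C(n, n − j)`). -/
theorem sum_range_choose_add_sum_range_choose_compl (n d : ℕ) (hd : d < n) :
    ∑ j ∈ Finset.range (d + 1), n.choose j + ∑ j ∈ Finset.range (n - d), n.choose j = 2 ^ n := by
  have h2 : ∑ j ∈ Finset.Ico (d + 1) (n + 1), n.choose j = ∑ j ∈ Finset.range (n - d), n.choose j := by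
    have hr := Finset.sum_Ico_reflect (fun j => n.choose j) (d + 1) (show n + 1 ≤ n + 1 from le_rfl)
    rw [show n + 1 - (n + 1) = 0 by omega, show n + 1 - (d + 1) = n - d by omega, ← Finset.range_eq_Ico] at hr
    rw [← hr]
    apply Finset.sum_congr rfl
    intro j hj
    rw [Finset.mem_Ico] at hj
    exact (Nat.choose_symm (show j ≤ n by omega)).symm
  have h3 : ∑ j ∈ Finset.range (d + 1), n.choose j + ∑ j ∈ Finset.Ico (d + 1) (n + 1), n.choose j = 2 ^ n := by
    rw [Finset.range_eq_Ico, Finset.sum_Ico_consecutive _ (by omega) (by omega), ← Finset.range_eq_Ico,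
      Nat.sum_range_choose]
  rw [← h2]
  exact h3

/-- **The geometric bound below the middle**: for `2m ≤ n`,
`(n + 1 − 2m)·Σ_{j ≤ m} C(n, j) ≤ (n + 1 − m)·C(n, m)` (the ratio `C(n, j − 1)/C(n, j) = j/(n − j + 1) ≤ m/(n − m + 1)`
for `j ≤ m`, summed as a geometric series). -/
theorem sum_range_choose_mul_le_of_two_mul_le (n : ℕ) : ∀ m : ℕ, 2 * m ≤ n →
    (n + 1 - 2 * m) * ∑ j ∈ Finset.range (m + 1), n.choose j ≤ (n + 1 - m) * n.choose m := by
  intro m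
  induction m with
  | zero => intro _; simp
  | succ m ih =>
    intro hm
    have ih' := ih (by omega)
    -- `C(n, m + 1)·(m + 1) = C(n, m)·(n − m)`
    have hrec : n.choose (m + 1) * (m + 1) = n.choose m * (n - m) := Nat.choose_succ_right_eq n m
    rw [Finset.sum_range_succ, Nat.mul_add]
    obtain ⟨x, hx⟩ : ∃ x, x = n + 1 - 2 * (m + 1) := ⟨_, rfl⟩
    obtain ⟨y, hy⟩ : ∃ y, y = n + 1 - (m + 1) := ⟨_, rfl⟩
    have e1 : n + 1 - 2 * m = x + 2 := by omega
    have e2 : n + 1 - m = y + 1 := by omega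
    have e3 : n - m = y := by omega
    have e4 : y = m + 1 + x := by omega
    have hxy : x ≤ 2 * y := by omega
    rw [← hx, ← hy]
    rw [e1, e2] at ih'
    rw [e3] at hrec
    set S := ∑ j ∈ Finset.range (m + 1), n.choose j with hS
    set A := n.choose m with hA
    set B := n.choose (m + 1) with hB
    -- `ih' : (x + 2)·S ≤ (y + 1)·A`, `hrec : B·(m + 1) = A·y`; first `x·S ≤ y·A` (from `x ≤ 2y`)
    have key : x * S ≤ y * A := by
      have h0 : x * (y + 1) ≤ y * (x + 2) := by nlinarith [hxy]
      have h1 : x * (y + 1) * S ≤ y * (x + 2) * S := Nat.mul_le_mul_right S h0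
      have h2 : y * ((x + 2) * S) ≤ y * ((y + 1) * A) := Nat.mul_le_mul_left y ih'
      have h3 : (y + 1) * (x * S) ≤ (y + 1) * (y * A) := by
        calc (y + 1) * (x * S) = x * (y + 1) * S := by ring
          _ ≤ y * (x + 2) * S := h1
          _ = y * ((x + 2) * S) := by ring
          _ ≤ y * ((y + 1) * A) := h2
          _ = (y + 1) * (y * A) := by ring
      exact Nat.le_of_mul_le_mul_left h3 (by omega)
    calc x * S + x * B ≤ y * A + x * B := Nat.add_le_add_right key _
      _ = B * (m + 1) + x * B := by rw [hrec]; ring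
      _ = y * B := by rw [e4]; ring

/-- **A base tail inequality from the symmetric complement**: `a·(G′ + T) ≤ b·N` from `T + S = N`, any `S_K ≤ S`, and
the numeric `a·(G′ + N) ≤ b·N + a·S_K`. -/
theorem tailG_le_of_compl (a b Gp T S SK N : ℕ) (hsym : T + S = N) (hK : SK ≤ S)
    (hnum : a * (Gp + N) ≤ b * N + a * SK) : a * (Gp + T) ≤ b * N := by
  have h1 : a * (Gp + T) + a * S = a * (Gp + N) := by rw [← hsym]; ring
  have h2 : a * SK ≤ a * S := Nat.mul_le_mul_left a hK
  omega

/-- **A base tail inequality from the geometric bound**: `a·(G′ + T) ≤ b·N` from `T = low + top`, `w·low ≤ v·c` with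
`0 < w`, and the numeric `w·a·(G′ + top) + a·c·v ≤ w·b·N`. -/
theorem tailG_le_of_geom (a b Gp T low top w v c N : ℕ) (hw : 0 < w) (hsplit : T = low + top)
    (hgeom : w * low ≤ v * c) (hnum : w * a * (Gp + top) + a * c * v ≤ w * b * N) : a * (Gp + T) ≤ b * N := by
  have h1 : w * (a * (Gp + T)) = w * a * (Gp + top) + a * (w * low) := by rw [hsplit]; ring
  have h2 : a * (w * low) ≤ a * (v * c) := Nat.mul_le_mul_left a hgeom
  have h3 : w * (a * (Gp + T)) ≤ w * (b * N) := by
    calc w * (a * (Gp + T)) = w * a * (Gp + top) + a * (w * low) := h1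
      _ ≤ w * a * (Gp + top) + a * (v * c) := Nat.add_le_add_left h2 _
      _ = w * a * (Gp + top) + a * c * v := by ring
      _ ≤ w * b * N := hnum
      _ = w * (b * N) := by ring
  exact Nat.le_of_mul_le_mul_left h3 hw

/-- The spanning tail split at `m ≤ d`: `Σ_{j ≤ d} C(n, j) = Σ_{j ≤ m} C(n, j) + Σ_{m < j ≤ d} C(n, j)`. -/
theorem sum_range_choose_split (n m d : ℕ) (hmd : m ≤ d) :
    ∑ j ∈ Finset.range (d + 1), n.choose j =
      ∑ j ∈ Finset.range (m + 1), n.choose j + ∑ j ∈ Finset.Ico (m + 1) (d + 1), n.choose j := by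
  rw [Finset.range_eq_Ico, Finset.range_eq_Ico, Finset.sum_Ico_consecutive _ (by omega) (by omega)]

/-- A sub-sum of the complement: `Σ_{j ∈ Ico a P} C(n, j) ≤ Σ_{j < P} C(n, j)`. -/
theorem sum_Ico_choose_le_sum_range (n a P : ℕ) :
    ∑ j ∈ Finset.Ico a P, n.choose j ≤ ∑ j ∈ Finset.range P, n.choose j := by
  rw [Finset.range_eq_Ico]
  exact Finset.sum_le_sum_of_subset (Finset.Ico_subset_Ico_left (Nat.zero_le a))

end ThmN

end PercRepro
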